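import Summits.Ventures.LatticeQCDFlow.Scaling.SimulatedTemperingModeGap
import Literature.Probability.MarkovChains.ExpanderMixingTime

/-!
HONEST FRAMING: exact (Metropolis-corrected) sampling algorithms for lattice gauge theory; figures
of merit are autocorrelation/cost numbers at stated couplings and volumes; no continuum-physics
claim.

# SimulatedTemperingMixingTime — FROM ANY START, THE LAZY SIMULATED-TEMPERING SAMPLER IS WITHIN `ε` OF THE TARGET IN
# TOTAL VARIATION AFTER `⌈(2/γ)(½log((K+1)/μ_min) + log(1/(2ε)))⌉` STEPS, `γ` ANY OF THE CHAPTER X/Y GAP FLOORS: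
# `t_mix(ε) ≤ ⌈(50(K+1)/(pγ_A·min{δ/K, γ₀}))·(½log((K+1)/μ_min) + log(1/(2ε)))⌉` (lean-2 GEN-17, ours)

Venture-side (OURS).  Cell `lqcd-flow` (pub-lqcd), unit `pub-lqcd-lean-2-g17`, 2026-08-25.  Chapters X–Z state their
guarantees as spectral gaps / integrated autocorrelation times (equilibrium currency).  What a cold start needs —
"how many steps until the level-and-configuration law is `ε`-close to `π(k,x) = μ_k(x)/(K+1)` in total variation,
WHATEVER the initial state" — is the MIXING TIME, and the Literature carries the bridge PROVED: Levin–Peres–Wilmer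
Theorem 12.4 (`SpectralMixingTimeBound.LevinPeres2017_thm_12_4_sharp`, `t_mix(ε) ≤ ⌈t_rel(½log(1/π_min) +
log(1/(2ε)))⌉`) for the LAZY version `P_L = (I+P)/2` (`ExpanderMixingTime.lazyVersion`; `t_rel(P_L) = 2/γ(P)` by
Exercise 12.3, `relaxationTime_lazyVersion`).  Laziness (do nothing with probability `½`) is the textbook device that
removes the negative spectrum; it costs the factor `2` and nothing else.

## What is proved

* §1 generic **`mixingTime_lazyVersion_le_of_gap`** — `Q` row-stochastic, reversible w.r.t. a positive probability
  vector `π`, irreducible, `|X| ≥ 2`, `0 < c ≤ γ(Q)`, `0 < π_min ≤ π`, `0 < ε ≤ ½` ⇒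
  `t_mix(lazyVersion Q; ε) ≤ ⌈(2/c)(½log(1/π_min) + log(1/(2ε)))⌉`.
* §2 the sampler of chapter X (`Scaling/SimulatedTemperingFiniteGap.stFin_spectralGap_ge`: adjacent overlaps `≥ a`,
  GLOBAL within-level Poincaré constant `γ` at every level): **`stFin_mixingTime_le`** —
  `t_mix(lazy stFinSampler t μ M; ε) ≤ ⌈(2/min{ta/(3(K+1)²), a(1−t)γ/(3(K+1)²+a)})·(½log((K+1)/m) + log(1/(2ε)))⌉`
  for `m ≤ μ_k(x)`.
* §3 the "modes as blocks" floor of chapter Y (`Scaling/SimulatedTemperingModeGap.stFinModeHalf_spectralGap_ge`,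
  `t = ½`: persistence `p`, mode-restricted overlaps `δ`, within-MODE constants `γ_A`, hot-level constant `γ₀` —
  nothing about the cold levels' barrier crossing): **`stFinMode_mixingTime_le`** —
  `t_mix(lazy stFinSampler ½ μ M; ε) ≤ ⌈(50(K+1)/(pγ_A·min{δ/K, γ₀}))·(½log((K+1)/m) + log(1/(2ε)))⌉`;
  **`stFinMode_mixingTime_quarter_le`** — at `ε = ¼`: `⌈(50(K+1)/(pγ_A·min{δ/K,γ₀}))·(½log((K+1)/m) + log 2)⌉`.

Reading (no numerics implied): polynomial in the ladder (`K(K+1)` or `(K+1)/γ₀`), linear in `1/(pγ_Aδ)`, and only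
LOGARITHMIC in `1/μ_min` — for an extensive action `log(1/μ_min) ∝ volume × window`, so the cold-start overhead over
the equilibrium guarantees of chapter Y is a volume factor, not an exponential.  NOT CLAIMED: the non-lazy sampler
(its negative spectrum is not controlled here); lower bounds on `t_mix`; anything measured.  Literature grade (cell
rule): TEXTBOOK (Thm 12.4 + Exercise 12.3, both PROVED in the tree), NEW TYPING for the tempering sampler; no new
bib keys.
-/

noncomputable section

open Finset
open Literature.Probability.MarkovChains
open Literature.Probability.MarkovChains.Decomposition

namespace Summit.Ventures.LatticeQCDFlow.Scaling

/-! ## §1 Mixing time of the lazy version from a gap floor -/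

section Generic

variable {X : Type*} [Fintype X] [DecidableEq X] {Q : Matrix X X ℝ} {π : X → ℝ}

/-- **`t_mix(P_L; ε) ≤ ⌈(2/c)(½log(1/π_min) + log(1/(2ε)))⌉` from a gap floor `0 < c ≤ γ(Q)`** (reversible,
irreducible `Q`, positive probability vector `π ≥ π_min > 0`, `0 < ε ≤ ½`): Theorem 12.4 for the lazy version,
`t_rel(P_L) = 2/γ(Q) ≤ 2/c`. [ours] -/
theorem mixingTime_lazyVersion_le_of_gap [Nontrivial X] (hπ : ∀ x, 0 < π x) (hπ1 : ∑ x, π x = 1)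
    (hQ : IsRowStochastic Q) (hDB : DetailedBalance π Q) (hirr : IsIrreducible Q) {c : ℝ} (hc : 0 < c)
    (hgap : c ≤ spectralGap π Q) {πmin : ℝ} (hmin0 : 0 < πmin) (hmin : ∀ x, πmin ≤ π x) {ε : ℝ}
    (hε : 0 < ε) (hε2 : ε ≤ 1 / 2) :
    mixingTime (lazyVersion Q) π ε ≤ ⌈2 / c * (Real.log (1 / πmin) / 2 + Real.log (1 / (2 * ε)))⌉₊ := by
  have hγpos : 0 < spectralGap π Q := lt_of_lt_of_le hc hgap
  -- `γ⋆(P_L) = γ(Q)/2 > 0`, so `λ⋆(P_L) < 1` and `t_rel(P_L) = 2/γ(Q) ≤ 2/c`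
  have hstar := absSpectralGap_lazyVersion hπ hπ1 hQ hDB hirr
  have hlam : lambdaStar (lazyVersion Q) < 1 := by
    have : 0 < absSpectralGap (lazyVersion Q) := by rw [hstar]; positivity
    unfold absSpectralGap at this
    linarith
  have htrel : relaxationTime (lazyVersion Q) ≤ 2 / c := by
    rw [relaxationTime_lazyVersion hπ hπ1 hQ hDB hirr]
    exact div_le_div_of_nonneg_left (by norm_num) hc hgap
  have h124 := LevinPeres2017_thm_12_4_sharp hπ hπ1 (lazyVersion_isRowStochastic hQ)
    (lazyVersion_detailedBalance hDB) (lazyVersion_isIrreducible hQ.1 hirr) hlam hmin0 hmin hε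
  refine h124.trans (Nat.ceil_mono ?_)
  have hπmin1 : πmin ≤ 1 := by
    obtain ⟨x₀⟩ := (inferInstance : Nonempty X)
    calc πmin ≤ π x₀ := hmin x₀
      _ ≤ ∑ x, π x := Finset.single_le_sum (fun x _ => (hπ x).le) (mem_univ x₀)
      _ = 1 := hπ1
  have hbr : 0 ≤ Real.log (1 / πmin) / 2 + Real.log (1 / (2 * ε)) := by
    have h1 : 0 ≤ Real.log (1 / πmin) := Real.log_nonneg (by rw [le_div_iff₀ hmin0]; linarith)
    have h2 : 0 ≤ Real.log (1 / (2 * ε)) := Real.log_nonneg (by rw [le_div_iff₀ (by positivity)]; linarith)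
    positivity
  exact mul_le_mul_of_nonneg_right htrel hbr

end Generic

/-! ## §2 The sampler of chapter X: overlaps and global within-level gaps -/

section Global

variable {S : Type*} [Fintype S] [DecidableEq S] {K : ℕ} {μ : Fin (K + 1) → S → ℝ}
  {M : Fin (K + 1) → Matrix S S ℝ} {t : ℝ}

omit [Fintype S] [DecidableEq S] in
/-- A uniform lower bound `m ≤ μ_k(x)` gives `π_min ≥ m/(K+1)` for the tempering target. [ours] -/
theorem stFinLaw_ge_of_le {m : ℝ} (hm : ∀ k x, m ≤ μ k x) (p : Fin (K + 1) × S) : m / (K + 1) ≤ stFinLaw μ p :=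
  div_le_div_of_nonneg_right (hm p.1 p.2) (by positivity)

/-- **MIXING TIME OF LAZY SIMULATED TEMPERING FROM OVERLAPS AND GLOBAL WITHIN-LEVEL GAPS** (`0 < t < 1`, `K ≥ 1`,
irreducible `μ_k`-reversible `M_k` with `γ·Var_{μ_k} ≤ 𝓔_{μ_k}(M_k;·)`, adjacent overlaps `≥ a`, `m ≤ μ_k(x)`):
`t_mix(lazy; ε) ≤ ⌈(2/min{ta/(3(K+1)²), a(1−t)γ/(3(K+1)²+a)})·(½log((K+1)/m) + log(1/(2ε)))⌉`. [ours] -/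
theorem stFin_mixingTime_le (hK : 1 ≤ K) (hμ : ∀ k x, 0 < μ k x) (hμ1 : ∀ k, ∑ x, μ k x = 1)
    (hM : ∀ k, IsRowStochastic (M k)) (hMrev : ∀ k, DetailedBalance (μ k) (M k))
    (hMirr : ∀ k, IsIrreducible (M k)) (ht0 : 0 < t) (ht1 : t < 1) {a γ : ℝ} (ha : 0 < a) (hγ : 0 < γ)
    (hov : ∀ i j : Fin (K + 1), (j.val = i.val + 1 ∨ i.val = j.val + 1) → a ≤ stFinOverlap μ i j)
    (hgap : ∀ k, ∀ h : S → ℝ, γ * lawVariance (μ k) h ≤ dirichletForm (μ k) (M k) h)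
    {m : ℝ} (hm0 : 0 < m) (hm : ∀ k x, m ≤ μ k x) {ε : ℝ} (hε : 0 < ε) (hε2 : ε ≤ 1 / 2) :
    mixingTime (lazyVersion (stFinSampler t μ M)) (stFinLaw μ) ε
      ≤ ⌈2 / min (t * a / (3 * (K + 1) ^ 2)) (a * (1 - t) * γ / (3 * (K + 1) ^ 2 + a))
          * (Real.log ((K + 1) / m) / 2 + Real.log (1 / (2 * ε)))⌉₊ := by
  haveI : Nonempty S := by
    by_contra h
    rw [not_nonempty_iff] at h
    have := hμ1 0
    rw [Finset.univ_eq_empty, Finset.sum_empty] at this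
    exact zero_ne_one this
  haveI : Nontrivial (Fin (K + 1)) := Fin.nontrivial_iff_two_le.mpr (by omega)
  have hc : 0 < min (t * a / (3 * (K + 1) ^ 2)) (a * (1 - t) * γ / (3 * (K + 1) ^ 2 + a)) := by
    have h1t : 0 < 1 - t := by linarith
    exact lt_min (by positivity) (by positivity)
  have h := mixingTime_lazyVersion_le_of_gap (stFinLaw_pos hμ) (sum_stFinLaw hμ1)
    (stFinSampler_isRowStochastic hμ hM ht0.le ht1.le) (stFinSampler_detailedBalance hμ hMrev)
    (stFinSampler_isIrreducible hμ hM hMirr ht0 ht1) hc (stFin_spectralGap_ge hK hμ hμ1 hM hMrev ht0 ht1 ha hγ hov hgap)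
    (πmin := m / (K + 1)) (by positivity) (stFinLaw_ge_of_le hm) hε hε2
  have e : (1 : ℝ) / (m / (K + 1)) = (K + 1) / m := one_div_div _ _
  rwa [e] at h

end Global

/-! ## §3 The "modes as blocks" floor of chapter Y -/

section Mode

variable {S J : Type*} [Fintype S] [DecidableEq S] [Fintype J] [DecidableEq J] {K : ℕ}
  {μ : Fin (K + 1) → S → ℝ} {M : Fin (K + 1) → Matrix S S ℝ} {mode : S → J}

/-- **MIXING TIME OF LAZY SIMULATED TEMPERING FROM WITHIN-MODE MIXING, HOT-LEVEL MIXING, PERSISTENCE AND OVERLAPS**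
(`t = ½`, the hypotheses of `Scaling/SimulatedTemperingModeGap.stFinModeHalf_spectralGap_ge` plus irreducible `M_k`
and `m ≤ μ_k(x)`): for `0 < ε ≤ ½`,
`t_mix(lazy; ε) ≤ ⌈(2/(pγ_A·min{δ/K,γ₀}/(25(K+1))))·(½log((K+1)/m) + log(1/(2ε)))⌉`. [ours] -/
theorem stFinMode_mixingTime_le (hμ : ∀ k x, 0 < μ k x) (hμ1 : ∀ k, ∑ x, μ k x = 1)
    (hmode : Function.Surjective mode) (hK : 1 ≤ K) (hM : ∀ k, IsRowStochastic (M k))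
    (hMrev : ∀ k, DetailedBalance (μ k) (M k)) (hMirr : ∀ k, IsIrreducible (M k))
    {p δ γ₀ γA : ℝ} (hp : 0 < p) (hp1 : p ≤ 1) (hδ0 : 0 < δ) (hδ1 : δ ≤ 1) (hγ₀ : 0 < γ₀)
    (hγA : 0 < γA) (hγA1 : γA ≤ 1)
    (hpers : ∀ (k l : Fin (K + 1)) (j : J), k ≤ l → p * blockMass (μ l) mode j ≤ blockMass (μ k) mode j)
    (hδ : ∀ (l : Fin K) (j : J), δ * min (blockMass (μ l.castSucc) mode j) (blockMass (μ l.succ) mode j)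
      ≤ ∑ x ∈ block mode j, min (μ l.castSucc x) (μ l.succ x))
    (hgap0 : ∀ h : S → ℝ, γ₀ * lawVariance (μ 0) h ≤ dirichletForm (μ 0) (M 0) h)
    (hgapA : ∀ k j, ∀ h : S → ℝ, γA * lawVariance (blockLaw (μ k) mode j) h
      ≤ dirichletForm (blockLaw (μ k) mode j) (restrictionChain (M k) mode) h)
    {m : ℝ} (hm0 : 0 < m) (hm : ∀ k x, m ≤ μ k x) {ε : ℝ} (hε : 0 < ε) (hε2 : ε ≤ 1 / 2) :
    mixingTime (lazyVersion (stFinSampler (1 / 2) μ M)) (stFinLaw μ) ε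
      ≤ ⌈2 / (p * γA * min (δ / K) γ₀ / (25 * (K + 1)))
          * (Real.log ((K + 1) / m) / 2 + Real.log (1 / (2 * ε)))⌉₊ := by
  haveI : Nonempty S := by
    by_contra h
    rw [not_nonempty_iff] at h
    have := hμ1 0
    rw [Finset.univ_eq_empty, Finset.sum_empty] at this
    exact zero_ne_one this
  haveI : Nontrivial (Fin (K + 1)) := Fin.nontrivial_iff_two_le.mpr (by omega)
  have ht0 : (0 : ℝ) < 1 / 2 := by norm_num
  have ht1 : (1 / 2 : ℝ) < 1 := by norm_num
  have hKr : (1 : ℝ) ≤ K := by exact_mod_cast hK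
  have hc : 0 < p * γA * min (δ / K) γ₀ / (25 * (K + 1)) := by
    have : 0 < min (δ / K) γ₀ := lt_min (div_pos hδ0 (by linarith)) hγ₀
    positivity
  have h := mixingTime_lazyVersion_le_of_gap (stFinLaw_pos hμ) (sum_stFinLaw hμ1)
    (stFinSampler_isRowStochastic hμ hM ht0.le ht1.le) (stFinSampler_detailedBalance hμ hMrev)
    (stFinSampler_isIrreducible hμ hM hMirr ht0 ht1) hc
    (stFinModeHalf_spectralGap_ge hμ hμ1 hmode hK hM hMrev hp hp1 hδ0 hδ1 hγ₀ hγA hγA1 hpers hδ hgap0 hgapA)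
    (πmin := m / (K + 1)) (by positivity) (stFinLaw_ge_of_le hm) hε hε2
  have e : (1 : ℝ) / (m / (K + 1)) = (K + 1) / m := one_div_div _ _
  rwa [e] at h

/-- **At `ε = ¼`:** `t_mix(lazy) ≤ ⌈(50(K+1)/(pγ_A·min{δ/K,γ₀}))·(½log((K+1)/m) + log 2)⌉`. [ours] -/
theorem stFinMode_mixingTime_quarter_le (hμ : ∀ k x, 0 < μ k x) (hμ1 : ∀ k, ∑ x, μ k x = 1)
    (hmode : Function.Surjective mode) (hK : 1 ≤ K) (hM : ∀ k, IsRowStochastic (M k))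
    (hMrev : ∀ k, DetailedBalance (μ k) (M k)) (hMirr : ∀ k, IsIrreducible (M k))
    {p δ γ₀ γA : ℝ} (hp : 0 < p) (hp1 : p ≤ 1) (hδ0 : 0 < δ) (hδ1 : δ ≤ 1) (hγ₀ : 0 < γ₀)
    (hγA : 0 < γA) (hγA1 : γA ≤ 1)
    (hpers : ∀ (k l : Fin (K + 1)) (j : J), k ≤ l → p * blockMass (μ l) mode j ≤ blockMass (μ k) mode j)
    (hδ : ∀ (l : Fin K) (j : J), δ * min (blockMass (μ l.castSucc) mode j) (blockMass (μ l.succ) mode j)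
      ≤ ∑ x ∈ block mode j, min (μ l.castSucc x) (μ l.succ x))
    (hgap0 : ∀ h : S → ℝ, γ₀ * lawVariance (μ 0) h ≤ dirichletForm (μ 0) (M 0) h)
    (hgapA : ∀ k j, ∀ h : S → ℝ, γA * lawVariance (blockLaw (μ k) mode j) h
      ≤ dirichletForm (blockLaw (μ k) mode j) (restrictionChain (M k) mode) h)
    {m : ℝ} (hm0 : 0 < m) (hm : ∀ k x, m ≤ μ k x) :
    mixingTime (lazyVersion (stFinSampler (1 / 2) μ M)) (stFinLaw μ) (1 / 4)
      ≤ ⌈50 * (K + 1) / (p * γA * min (δ / K) γ₀) * (Real.log ((K + 1) / m) / 2 + Real.log 2)⌉₊ := by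
  have h := stFinMode_mixingTime_le hμ hμ1 hmode hK hM hMrev hMirr hp hp1 hδ0 hδ1 hγ₀ hγA hγA1 hpers hδ hgap0 hgapA
    hm0 hm (ε := 1 / 4) (by norm_num) (by norm_num)
  have hKr : (1 : ℝ) ≤ K := by exact_mod_cast hK
  have hmin : 0 < min (δ / K) γ₀ := lt_min (div_pos hδ0 (by linarith)) hγ₀
  have h2 : Real.log (1 / (2 * (1 / 4 : ℝ))) = Real.log 2 := by norm_num
  have e : 2 / (p * γA * min (δ / K) γ₀ / (25 * (K + 1))) = 50 * (K + 1) / (p * γA * min (δ / K) γ₀) := by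
    have hne : p * γA * min (δ / K) γ₀ ≠ 0 := by positivity
    field_simp
    ring
  rwa [h2, e] at h

end Mode

end Summit.Ventures.LatticeQCDFlow.Scaling

end
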